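import Mathlib.Analysis.Complex.ExponentialBounds
import Summits.HubbardSuperconductivity.HubbardSuperconductivity.Theorems.KLProgrammeKLRegimeFlowReadScaleZeroSunsetTailKlEng
import Summits.HubbardSuperconductivity.HubbardSuperconductivity.Theorems.KLProgrammeKLRegimeFlowReadScaleZeroSunsetFarGapCertDefs

/-!
# Route `KLProgramme`, crux K3 — engine-flow child (stmt-HubbardSuperconductivity-20437), stub (C) at `n = 0`, located item #22a «(C)-SCALE0-PT2»:
# THE RECORD-LEVEL ONE-CALL FOR THE CERTIFIED SUNSET ROWS — `sunsetRows_of_records` (two records + a rational budget row ⇒ `hS0`/`hSk`)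

Seat hubbard-kl-k3c5-p1 (g15; owner of #22a).  The closer of record `…SunsetTailKlEng.sunsetRows_of_certV3_klEng` (p1 g22, p650061) delivers the certified rows
`hS0`/`hSk` of `…FlowReadScaleZeroAssembly.twoLegRead_frameZero_of_sunsetData` from the near certificate `ScaleZeroSunsetCertV3 c`, the regime, the two
Parseval-gap numbers `G₀, G₂` and ONE budget inequality `hbS` whose left side still contains `e^{−arsinh(ω₁/4)(Rc+1)}`, `arsinh`, `max`, and square roots of
the gaps — not a `norm_num` goal.  This file removes the last real-analysis step from INSTANTIATION:

* §1 elementary majorants at the crossover (`klE0 ≤ ω₁ ≤ 1/4`, `255 ≤ ω₁(Rc+1)`, e.g. `ω₁ = 1/4`, `Rc ≥ 1024`): `arsinh x ≥ x/(1+x)`, so `κ₁ = arsinh(ω₁/4) ≥ 4ω₁/17`,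
  `e^{−κ₁(Rc+1)} ≤ e^{−60} ≤ 10⁻²⁵` (`exp 1 > 2.7182818283`), `max(1, 2k/κ₁)ᵏ ≤ 544²`, `(1 + 2/(1−e^{−κ₁/4}))² ≤ 1091²`, hence the strip (high-shell) remainder
  `2ᵏ·2500·C(ω₁,Rc,k)/ω₁ ≤ 2·10⁻⁸` (`highShell_budget_le`) — the two-shells design made it negligible, this records the numeral;
* §2 `farBudget_le_rational`: the whole far term of `hbS` is `≤ (5·10⁻²⁴ + ω₁(s₀ + 10⁻¹⁰))·(2·10⁻⁸ + ω₁(t_k + 10⁻¹⁰)²)`, `t = (s₀, (s₀+s₂)/2, s₂)`, for any rationals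
  `s₀, s₂ ≥ 0` with `G₀ ≤ s₀²`, `0 ≤ G₂ ≤ s₂²` (square-root majorants that `gen_record.py` emits next to the record; row 1 by AM–GM on `G₁ = √(G₀G₂)`);
* §3 **`sunsetRows_of_records`** — THE CALL at instantiation time: inputs = the near record/cert (`SunsetCellRecordV3`, KIT JOB A), the far record/cert
  (`SunsetFarGapRecord`/`ScaleZeroFarGapCert`, KIT JOB B, p652354), the regime (`μ ∈ klWindowC ∩ cell`, `klBetaMin ≤ β`, `0 < U ≤ 2⁻²⁰`, `klEngL₃ β U ≤ L`,
  `klEngM₃ β U L ≤ M`), and ONLY RATIONAL side conditions on the record fields (`128 ≤ Rc`, `4Rc+2 ≤ 2¹⁰·129²·(2²⁰+1)² ≤ klEngL₃`, `10⁻³⁰ ≤ Tmax`, `0 ≤ row k`,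
  `1/32 ≤ ω₁ ≤ 1/4`, `255 ≤ ω₁(Rc+1)`, `0 ≤ G₂`, `G₀ ≤ s₀²`, `G₂ ≤ s₂²`, `0 ≤ s₀, s₂`) plus the budget row
  `row k + (5·10⁻²⁴ + ω₁(s₀+10⁻¹⁰))·(2·10⁻⁸ + ω₁(t_k+10⁻¹⁰)²) ≤ bS k` — every one of them `norm_num`/`decide` on literals.  Output: `hS0 ∧ hSk` verbatim.

So once the two kit certificates exist for a μ-cell, #22a's rows `k ≤ 2` are instantiated by `sunsetRows_of_records c hc r hr hμ … (by norm_num) … (by norm_num)`.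
SIZES [design, float]: with `ω₁ = 1/4` the far row is `≈ (s₀/4)·(t_k²/4)`; p1 g22's heuristic `D₀ ~ 10⁻⁷–10⁻¹⁰`, `D₂ ~ 1–30` near μ* at `Rc = 2048` gives far rows `≲ 10⁻⁴`
against targets `bS = (0.04, 0.16, 1.0)` — the float pass «gapsz» (kit j313657/j313659, this seat) measures the true gaps.
Proof files only; nothing here asserts (C), any stub of 20437, K3, the margin or superconductivity; the two certificates are HYPOTHESES.
References: BGM 2006 §2.3–§2.4 [cite: BenfattoGiulianiMastropietro2006].
-/

noncomputable section

namespace Summit.HubbardSuperconductivity.HubbardSuperconductivity.Theorems.KLRegimeSplit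

set_option linter.dupNamespace false -- summit = problem name (single-conjunct summit), D-0017

open Literature.MathematicalPhysics.QuantumLattice Literature.Probability.LatticeModels Literature.Analysis.FunctionSpaces
open Summit.HubbardSuperconductivity.HubbardSuperconductivity.Theorems.DispersionFlow
open Summit.HubbardSuperconductivity.HubbardSuperconductivity.Theorems.EngineV8
open MeasureTheory Finset Complex UnitAddTorus Real

/-! ## §1 Elementary majorants at the crossover -/


/-- `x/(1+x) ≤ arsinh x` for `0 ≤ x` (`arsinh x = log(x + √(1+x²)) ≥ log(1+x) ≥ 1 − 1/(1+x)`). -/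
theorem div_one_add_le_arsinh {x : ℝ} (hx : 0 ≤ x) : x / (1 + x) ≤ Real.arsinh x := by
  rw [Real.arsinh]
  have hs : (1 : ℝ) ≤ Real.sqrt (1 + x ^ 2) := (Real.le_sqrt (by norm_num) (by positivity)).2 (by nlinarith)
  have hpos : (0 : ℝ) < x + Real.sqrt (1 + x ^ 2) := by linarith
  have hlog := Real.one_sub_inv_le_log_of_pos hpos
  refine le_trans ?_ hlog
  have h2 : (1 + x : ℝ) ≤ x + Real.sqrt (1 + x ^ 2) := by linarith
  have h3 : (x + Real.sqrt (1 + x ^ 2))⁻¹ ≤ (1 + x : ℝ)⁻¹ := inv_anti₀ (by linarith) h2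
  have h4 : x / (1 + x) = 1 - (1 + x : ℝ)⁻¹ := by field_simp; ring
  rw [h4]
  linarith

/-- The strip rate at the crossover: `κ₁ = arsinh(ω₁/4) ≥ 4ω₁/17` for `0 ≤ ω₁ ≤ 1/4`. -/
theorem arsinh_quarter_ge {ω₁ : ℝ} (h0 : 0 ≤ ω₁) (h1 : ω₁ ≤ 1 / 4) : 4 * ω₁ / 17 ≤ Real.arsinh (ω₁ / 4) := by
  have h := div_one_add_le_arsinh (x := ω₁ / 4) (by positivity)
  refine le_trans ?_ h
  rw [div_le_div_iff₀ (by norm_num) (by positivity)]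
  nlinarith

/-- `e^{−60·(1 − 1/150)} ≤ 10⁻²⁵`-type numeral: `exp (−t) ≤ 10⁻²⁵` once `60 ≤ t`. -/
theorem exp_neg_le_ten_inv_pow_25 {t : ℝ} (ht : 60 ≤ t) : Real.exp (-t) ≤ (10 : ℝ)⁻¹ ^ 25 := by
  have h1 : Real.exp (-t) ≤ Real.exp (-60) := Real.exp_le_exp.2 (by linarith)
  refine h1.trans ?_
  have he : (2.7182818283 : ℝ) < Real.exp 1 := Real.exp_one_gt_d9
  have h60 : Real.exp 60 = Real.exp 1 ^ 60 := by
    rw [Real.exp_one_pow]; norm_num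
  have hpow : (2.7182818283 : ℝ) ^ 60 ≤ Real.exp 1 ^ 60 := pow_le_pow_left₀ (by norm_num) he.le 60
  have hbig : (10 : ℝ) ^ 25 ≤ Real.exp 60 := by
    rw [h60]; exact le_trans (by norm_num) hpow
  rw [Real.exp_neg, inv_pow]
  exact inv_anti₀ (by positivity) hbig


/-- **The strip (high-shell) constants at the crossover are negligible**: for `klE0 ≤ ω₁ ≤ 1/4` and `255 ≤ ω₁(Rc+1)`,
`e^{−κ₁(Rc+1)} ≤ 10⁻²⁵` (`κ₁ = arsinh(ω₁/4) ≥ 4ω₁/17`, exponent `≥ 60`). -/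
theorem exp_neg_arsinh_mul_le_of_le {ω₁ : ℝ} (hω₁ : klE0 ≤ ω₁) (hω₁' : ω₁ ≤ 1 / 4) {Rc : ℕ} (hRc : 255 ≤ ω₁ * ((Rc : ℝ) + 1)) :
    Real.exp (-(Real.arsinh (ω₁ / 4) * ((Rc : ℝ) + 1))) ≤ (10 : ℝ)⁻¹ ^ 25 := by
  have hE0 : (1 : ℝ) / 32 ≤ ω₁ := by have : klE0 = 1 / 32 := rfl; rw [← this]; exact hω₁
  have hκ := arsinh_quarter_ge (by linarith) hω₁'
  refine exp_neg_le_ten_inv_pow_25 ?_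
  have h1 : 4 * ω₁ / 17 * ((Rc : ℝ) + 1) ≤ Real.arsinh (ω₁ / 4) * ((Rc : ℝ) + 1) := mul_le_mul_of_nonneg_right hκ (by positivity)
  refine le_trans ?_ h1
  have : 4 * ω₁ / 17 * ((Rc : ℝ) + 1) = (4 / 17) * (ω₁ * ((Rc : ℝ) + 1)) := by ring
  rw [this]; linarith

/-- **The high-shell remainder of the far budget is `≤ 2·10⁻⁸`** for every row `k ≤ 2` (at `klE0 ≤ ω₁ ≤ 1/4`, `255 ≤ ω₁(Rc+1)`):
`2ᵏ·2500·max(1,2k/κ₁)ᵏ·e^{−κ₁(Rc+1)}·(1 + 2/(1 − e^{−κ₁/4}))²/ω₁ ≤ 4·2500·544²·10⁻²⁵·1091²·32 ≤ 2·10⁻⁸`. -/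
theorem highShell_budget_le {ω₁ : ℝ} (hω₁ : klE0 ≤ ω₁) (hω₁' : ω₁ ≤ 1 / 4) {Rc : ℕ} (hRc : 255 ≤ ω₁ * ((Rc : ℝ) + 1)) (k : Fin 3) :
    2 ^ (k : ℕ) * 2500 *
        ((max 1 ((2 * (k : ℕ) : ℝ) / Real.arsinh (ω₁ / 4))) ^ (k : ℕ) * Real.exp (-(Real.arsinh (ω₁ / 4) * (Rc + 1))) *
          (1 + 2 * (1 - Real.exp (-(Real.arsinh (ω₁ / 4) / 4)))⁻¹) ^ 2) / ω₁ ≤ 2 * (10 : ℝ)⁻¹ ^ 8 := by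
  have hE0 : (1 : ℝ) / 32 ≤ ω₁ := by have : klE0 = 1 / 32 := rfl; rw [← this]; exact hω₁
  have hω0 : 0 < ω₁ := by linarith
  have hκ := arsinh_quarter_ge hω0.le hω₁'
  have hκ' : (1 : ℝ) / 136 ≤ Real.arsinh (ω₁ / 4) := le_trans (by linarith) hκ
  have hκ0 : 0 < Real.arsinh (ω₁ / 4) := lt_of_lt_of_le (by norm_num) hκ'
  have hk2 : (k : ℕ) ≤ 2 := by have := k.isLt; omega
  -- the four factors
  have hA : (2 : ℝ) ^ (k : ℕ) ≤ 4 := by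
    calc (2 : ℝ) ^ (k : ℕ) ≤ 2 ^ 2 := pow_le_pow_right₀ (by norm_num) hk2
      _ = 4 := by norm_num
  have hB : (max 1 ((2 * (k : ℕ) : ℝ) / Real.arsinh (ω₁ / 4))) ^ (k : ℕ) ≤ 544 ^ 2 := by
    have hkr : ((k : ℕ) : ℝ) ≤ 2 := by exact_mod_cast hk2
    have hm : max 1 ((2 * (k : ℕ) : ℝ) / Real.arsinh (ω₁ / 4)) ≤ 544 := by
      refine max_le (by norm_num) ?_
      rw [div_le_iff₀ hκ0]
      calc (2 * (k : ℕ) : ℝ) ≤ 4 := by linarith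
        _ = 544 * (1 / 136) := by norm_num
        _ ≤ 544 * Real.arsinh (ω₁ / 4) := by gcongr
    calc (max 1 ((2 * (k : ℕ) : ℝ) / Real.arsinh (ω₁ / 4))) ^ (k : ℕ) ≤ 544 ^ (k : ℕ) :=
          pow_le_pow_left₀ (le_trans zero_le_one (le_max_left _ _)) hm _
      _ ≤ 544 ^ 2 := pow_le_pow_right₀ (by norm_num) hk2
  have hC : Real.exp (-(Real.arsinh (ω₁ / 4) * (Rc + 1))) ≤ (10 : ℝ)⁻¹ ^ 25 := exp_neg_arsinh_mul_le_of_le hω₁ hω₁' hRc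
  have hD : (1 + 2 * (1 - Real.exp (-(Real.arsinh (ω₁ / 4) / 4)))⁻¹) ^ 2 ≤ 1091 ^ 2 := by
    have hx : 0 < Real.arsinh (ω₁ / 4) / 4 := by positivity
    -- `(1 − e^{−x})⁻¹ ≤ 1 + 1/x` for `0 < x` (from `1 + x ≤ eˣ`; cf. `Balaban1983to89.B5Bound128Uniform.inv_one_sub_exp_neg_le`)
    have h1 : (1 - Real.exp (-(Real.arsinh (ω₁ / 4) / 4)))⁻¹ ≤ 1 + (Real.arsinh (ω₁ / 4) / 4)⁻¹ := by
      set x := Real.arsinh (ω₁ / 4) / 4 with hxdef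
      have e1 : Real.exp (-x) ≤ (1 + x)⁻¹ := by
        rw [Real.exp_neg]
        exact inv_anti₀ (by positivity) (by linarith [Real.add_one_le_exp x])
      have e2 : x / (1 + x) ≤ 1 - Real.exp (-x) := by
        have : x / (1 + x) = 1 - (1 + x)⁻¹ := by field_simp; ring
        rw [this]; linarith
      have e3 : 0 < x / (1 + x) := by positivity
      calc (1 - Real.exp (-x))⁻¹ ≤ (x / (1 + x))⁻¹ := inv_anti₀ e3 e2
        _ = 1 + x⁻¹ := by field_simp; ring
    have h2 : (Real.arsinh (ω₁ / 4) / 4)⁻¹ ≤ 544 := by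
      rw [inv_le_comm₀ hx (by norm_num)]
      have : (544 : ℝ)⁻¹ = (1 / 136) / 4 := by norm_num
      rw [this]; gcongr
    have h3 : (1 - Real.exp (-(Real.arsinh (ω₁ / 4) / 4)))⁻¹ ≤ 545 := by linarith
    have h4 : 0 ≤ (1 - Real.exp (-(Real.arsinh (ω₁ / 4) / 4)))⁻¹ := by
      refine inv_nonneg.2 ?_
      have : Real.exp (-(Real.arsinh (ω₁ / 4) / 4)) ≤ 1 := Real.exp_le_one_iff.2 (by linarith)
      linarith
    have h5 : 1 + 2 * (1 - Real.exp (-(Real.arsinh (ω₁ / 4) / 4)))⁻¹ ≤ 1091 := by linarith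
    exact pow_le_pow_left₀ (by linarith) h5 2
  have hω' : ω₁⁻¹ ≤ 32 := by rw [inv_le_comm₀ hω0 (by norm_num)]; linarith
  have hnonneg1 : 0 ≤ (max 1 ((2 * (k : ℕ) : ℝ) / Real.arsinh (ω₁ / 4))) ^ (k : ℕ) := by positivity
  calc 2 ^ (k : ℕ) * 2500 *
        ((max 1 ((2 * (k : ℕ) : ℝ) / Real.arsinh (ω₁ / 4))) ^ (k : ℕ) * Real.exp (-(Real.arsinh (ω₁ / 4) * (Rc + 1))) *
          (1 + 2 * (1 - Real.exp (-(Real.arsinh (ω₁ / 4) / 4)))⁻¹) ^ 2) / ω₁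
      = 2 ^ (k : ℕ) * 2500 *
        ((max 1 ((2 * (k : ℕ) : ℝ) / Real.arsinh (ω₁ / 4))) ^ (k : ℕ) * Real.exp (-(Real.arsinh (ω₁ / 4) * (Rc + 1))) *
          (1 + 2 * (1 - Real.exp (-(Real.arsinh (ω₁ / 4) / 4)))⁻¹) ^ 2) * ω₁⁻¹ := by rw [div_eq_mul_inv]
    _ ≤ 4 * 2500 * (544 ^ 2 * (10 : ℝ)⁻¹ ^ 25 * 1091 ^ 2) * 32 := by
        gcongr
    _ ≤ 2 * (10 : ℝ)⁻¹ ^ 8 := by norm_num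

/-- **Square-root majorants of the three gap numbers**: with `G₀ ≤ s₀²`, `0 ≤ G₂ ≤ s₂²`, `0 ≤ s₀, s₂`:
`√(![G₀, √(G₀G₂), G₂] k) ≤ ![s₀, (s₀+s₂)/2, s₂] k` (`k = 1` by AM–GM). -/
theorem sqrt_gapVec_le {G₀ G₂ s₀ s₂ : ℝ} (hG₂ : 0 ≤ G₂) (hs₀ : G₀ ≤ s₀ ^ 2) (hs₂ : G₂ ≤ s₂ ^ 2)
    (hs₀0 : 0 ≤ s₀) (hs₂0 : 0 ≤ s₂) (k : Fin 3) :
    Real.sqrt (![G₀, Real.sqrt (G₀ * G₂), G₂] k) ≤ ![s₀, (s₀ + s₂) / 2, s₂] k := by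
  have h0 : Real.sqrt G₀ ≤ s₀ := by rw [← Real.sqrt_sq hs₀0]; exact Real.sqrt_le_sqrt hs₀
  have h2 : Real.sqrt G₂ ≤ s₂ := by rw [← Real.sqrt_sq hs₂0]; exact Real.sqrt_le_sqrt hs₂
  fin_cases k
  · simpa using h0
  · simp only [Fin.mk_one, Matrix.cons_val_one, Matrix.cons_val_zero]
    have h12 : Real.sqrt (G₀ * G₂) ≤ s₀ * s₂ := by
      rw [← Real.sqrt_sq (mul_nonneg hs₀0 hs₂0), mul_pow]
      exact Real.sqrt_le_sqrt (mul_le_mul hs₀ hs₂ hG₂ (sq_nonneg _))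
    calc Real.sqrt (Real.sqrt (G₀ * G₂)) ≤ Real.sqrt (s₀ * s₂) := Real.sqrt_le_sqrt h12
      _ ≤ (s₀ + s₂) / 2 := by
          rw [Real.sqrt_le_iff]
          exact ⟨by positivity, by nlinarith [sq_nonneg (s₀ - s₂)]⟩
  · simpa using h2

/-- **THE FAR BUDGET OF `sunsetRows_of_certV3_klEng` MAJORISED BY A POLYNOMIAL IN RATIONALS** (at `klE0 ≤ ω₁ ≤ 1/4`, `255 ≤ ω₁(Rc+1)`):
`(50e^{−κ₁(Rc+1)} + ω₁(√G₀ + 10⁻¹⁰))·(2ᵏ·2500·C(ω₁,Rc,k)/ω₁ + ω₁(√G_k + 10⁻¹⁰)²) ≤ (5·10⁻²⁴ + ω₁(s₀ + 10⁻¹⁰))·(2·10⁻⁸ + ω₁(t_k + 10⁻¹⁰)²)`,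
`t = (s₀, (s₀+s₂)/2, s₂)`, for any `s₀, s₂ ≥ 0` with `G₀ ≤ s₀²`, `0 ≤ G₂ ≤ s₂²` — so that `gen_record.py` can emit rational `s₀, s₂` and the row check is `norm_num`. -/
theorem farBudget_le_rational {ω₁ : ℝ} (hω₁ : klE0 ≤ ω₁) (hω₁' : ω₁ ≤ 1 / 4) {Rc : ℕ} (hRc : 255 ≤ ω₁ * ((Rc : ℝ) + 1))
    {G₀ G₂ s₀ s₂ : ℝ} (hG₂ : 0 ≤ G₂) (hs₀ : G₀ ≤ s₀ ^ 2) (hs₂ : G₂ ≤ s₂ ^ 2) (hs₀0 : 0 ≤ s₀) (hs₂0 : 0 ≤ s₂)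
    (k : Fin 3) :
    (50 * Real.exp (-(Real.arsinh (ω₁ / 4) * (Rc + 1))) + ω₁ * Real.sqrt ((Real.sqrt (![G₀, Real.sqrt (G₀ * G₂), G₂] 0) + (10 : ℝ)⁻¹ ^ 10) ^ 2)) *
        (2 ^ (k : ℕ) * 2500 *
          ((max 1 ((2 * (k : ℕ) : ℝ) / Real.arsinh (ω₁ / 4))) ^ (k : ℕ) * Real.exp (-(Real.arsinh (ω₁ / 4) * (Rc + 1))) *
            (1 + 2 * (1 - Real.exp (-(Real.arsinh (ω₁ / 4) / 4)))⁻¹) ^ 2) / ω₁ +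
          ω₁ * (Real.sqrt (![G₀, Real.sqrt (G₀ * G₂), G₂] k) + (10 : ℝ)⁻¹ ^ 10) ^ 2) ≤
      (5 * (10 : ℝ)⁻¹ ^ 24 + ω₁ * (s₀ + (10 : ℝ)⁻¹ ^ 10)) * (2 * (10 : ℝ)⁻¹ ^ 8 + ω₁ * (![s₀, (s₀ + s₂) / 2, s₂] k + (10 : ℝ)⁻¹ ^ 10) ^ 2) := by
  have hE0 : (1 : ℝ) / 32 ≤ ω₁ := by have : klE0 = 1 / 32 := rfl; rw [← this]; exact hω₁
  have hω0 : 0 ≤ ω₁ := by linarith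
  have hE := exp_neg_arsinh_mul_le_of_le hω₁ hω₁' hRc
  have hH := highShell_budget_le hω₁ hω₁' hRc k
  have ht := sqrt_gapVec_le hG₂ hs₀ hs₂ hs₀0 hs₂0
  -- first factor
  have h0' : Real.sqrt ((Real.sqrt (![G₀, Real.sqrt (G₀ * G₂), G₂] 0) + (10 : ℝ)⁻¹ ^ 10) ^ 2) ≤ s₀ + (10 : ℝ)⁻¹ ^ 10 := by
    rw [Real.sqrt_sq (by positivity)]
    have := ht 0
    simp only [Matrix.cons_val_zero] at this ⊢
    linarith
  have hF1 : 50 * Real.exp (-(Real.arsinh (ω₁ / 4) * (Rc + 1))) + ω₁ * Real.sqrt ((Real.sqrt (![G₀, Real.sqrt (G₀ * G₂), G₂] 0) + (10 : ℝ)⁻¹ ^ 10) ^ 2) ≤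
      5 * (10 : ℝ)⁻¹ ^ 24 + ω₁ * (s₀ + (10 : ℝ)⁻¹ ^ 10) := by
    have : 50 * Real.exp (-(Real.arsinh (ω₁ / 4) * (Rc + 1))) ≤ 5 * (10 : ℝ)⁻¹ ^ 24 := by
      calc 50 * Real.exp (-(Real.arsinh (ω₁ / 4) * (Rc + 1))) ≤ 50 * (10 : ℝ)⁻¹ ^ 25 := by gcongr
        _ = 5 * (10 : ℝ)⁻¹ ^ 24 := by norm_num
    exact add_le_add this (mul_le_mul_of_nonneg_left h0' hω0)
  -- second factor
  have htk : Real.sqrt (![G₀, Real.sqrt (G₀ * G₂), G₂] k) + (10 : ℝ)⁻¹ ^ 10 ≤ ![s₀, (s₀ + s₂) / 2, s₂] k + (10 : ℝ)⁻¹ ^ 10 := by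
    linarith [ht k]
  have hF2 : 2 ^ (k : ℕ) * 2500 *
          ((max 1 ((2 * (k : ℕ) : ℝ) / Real.arsinh (ω₁ / 4))) ^ (k : ℕ) * Real.exp (-(Real.arsinh (ω₁ / 4) * (Rc + 1))) *
            (1 + 2 * (1 - Real.exp (-(Real.arsinh (ω₁ / 4) / 4)))⁻¹) ^ 2) / ω₁ +
          ω₁ * (Real.sqrt (![G₀, Real.sqrt (G₀ * G₂), G₂] k) + (10 : ℝ)⁻¹ ^ 10) ^ 2 ≤
      2 * (10 : ℝ)⁻¹ ^ 8 + ω₁ * (![s₀, (s₀ + s₂) / 2, s₂] k + (10 : ℝ)⁻¹ ^ 10) ^ 2 := by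
    refine add_le_add hH (mul_le_mul_of_nonneg_left ?_ hω0)
    exact pow_le_pow_left₀ (by positivity) htk 2
  have hnn1 : 0 ≤ 50 * Real.exp (-(Real.arsinh (ω₁ / 4) * (Rc + 1))) +
      ω₁ * Real.sqrt ((Real.sqrt (![G₀, Real.sqrt (G₀ * G₂), G₂] 0) + (10 : ℝ)⁻¹ ^ 10) ^ 2) := by positivity
  exact mul_le_mul hF1 hF2 (by positivity) (le_trans hnn1 hF1)


/-! ## §3 The record-level one-call -/

section Records

open GrassmannAlgebra Matrix Set
open scoped FourierTransform NNReal

variable {L M : ℕ} [NeZero L]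

/-- **THE CERTIFIED SUNSET ROWS FROM THE TWO RECORDS** — `sunsetRows_of_certV3_klEng` with the far certificate read by `hgaps_of_farGapCert` and its budget row
replaced by the rational majorant of `farBudget_le_rational`.  Every side condition is a closed rational inequality on record fields (or on the two emitted
square-root majorants `s₀, s₂`), decidable by `norm_num` at instantiation; the regime hypotheses are the engine's. -/
theorem sunsetRows_of_records [NeZero M] (c : SunsetCellRecordV3) (hc : ScaleZeroSunsetCertV3 c)
    (r : SunsetFarGapRecord) (hr : ScaleZeroFarGapCert c.toSunsetCellRecordV2 r)
    {μ β U : ℝ} (hμ : μ ∈ klWindowC) (hμlo : (c.μlo : ℝ) ≤ μ) (hμhi : μ ≤ c.μhi)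
    (hβ : klBetaMin ≤ β) (hU0 : 0 < U) (hU : U ≤ (2 : ℝ)⁻¹ ^ 20) (hL3 : klEngL₃ β U ≤ L) (hM3 : klEngM₃ β U L ≤ M)
    -- rational side conditions on the near record
    (hRc : 128 ≤ c.Rc) (hRc' : 4 * c.Rc + 2 ≤ 2 ^ 10 * 129 ^ 2 * (2 ^ 20 + 1) ^ 2)
    (hTmax : (10 : ℚ)⁻¹ ^ 30 ≤ c.Tmax) (hrow : ∀ k : Fin 3, 0 ≤ c.row k)
    -- rational side conditions on the far record and its square-root majorants
    (hω₁ : (1 : ℚ) / 32 ≤ r.ω₁) (hω₁' : r.ω₁ ≤ 1 / 4) (hωRc : 255 ≤ r.ω₁ * ((c.Rc : ℚ) + 1)) (hG₂ : 0 ≤ r.G₂)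
    {s₀ s₂ : ℚ} (hs₀ : r.G₀ ≤ s₀ ^ 2) (hs₂ : r.G₂ ≤ s₂ ^ 2) (hs₀0 : 0 ≤ s₀) (hs₂0 : 0 ≤ s₂)
    -- the budget row
    {bS : ℕ → ℝ}
    (hbS : ∀ k : Fin 3, (c.row k : ℝ) +
      (5 * (10 : ℝ)⁻¹ ^ 24 + (r.ω₁ : ℝ) * ((s₀ : ℝ) + (10 : ℝ)⁻¹ ^ 10)) *
        (2 * (10 : ℝ)⁻¹ ^ 8 + (r.ω₁ : ℝ) * (![(s₀ : ℝ), ((s₀ : ℝ) + s₂) / 2, (s₂ : ℝ)] k + (10 : ℝ)⁻¹ ^ 10) ^ 2) ≤ bS k) :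
    (∀ (σ : Fin 2) (p₀ : GridPoint L (2 * (2 * M))), ∑ p₁ : GridPoint L (2 * (2 * M)),
      (if p₁ = p₀ then (0 : ℝ) else (if p₁.2 - p₀.2 = 0 then (0 : ℝ) else 1) * ‖contr ℂ ((hubbardGridSub L M β (2 * (2 * M))).transpose * hubbardCovAboveCT L M β μ 0 0 klE0 *
                hubbardGridSub L M β (2 * (2 * M))) (((p₁, σ), 0) : GridLeg (GridPoint L (2 * (2 * M)))) ((p₀, σ), 1) *
              (contr ℂ ((hubbardGridSub L M β (2 * (2 * M))).transpose * hubbardCovAboveCT L M β μ 0 0 klE0 *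
                hubbardGridSub L M β (2 * (2 * M))) (((p₀, σ.rev), 0) : GridLeg (GridPoint L (2 * (2 * M)))) ((p₁, σ.rev), 1) *
                contr ℂ ((hubbardGridSub L M β (2 * (2 * M))).transpose * hubbardCovAboveCT L M β μ 0 0 klE0 *
                hubbardGridSub L M β (2 * (2 * M))) (((p₁, σ.rev), 0) : GridLeg (GridPoint L (2 * (2 * M)))) ((p₀, σ.rev), 1))‖) ≤ bS 0 * (((2 * (2 * M) : ℕ) : ℝ) / β)) ∧
    (∀ k, 1 ≤ k → k ≤ 2 → ∀ (σ : Fin 2) (p₀ : GridPoint L (2 * (2 * M))), ∑ p₁ : GridPoint L (2 * (2 * M)),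
      (if p₁ = p₀ then (0 : ℝ) else
        Real.sqrt ((((p₁.2 - p₀.2) 0).valMinAbs.natAbs : ℝ) ^ 2 + (((p₁.2 - p₀.2) 1).valMinAbs.natAbs : ℝ) ^ 2) ^ k * ‖contr ℂ ((hubbardGridSub L M β (2 * (2 * M))).transpose * hubbardCovAboveCT L M β μ 0 0 klE0 *
                hubbardGridSub L M β (2 * (2 * M))) (((p₁, σ), 0) : GridLeg (GridPoint L (2 * (2 * M)))) ((p₀, σ), 1) *
              (contr ℂ ((hubbardGridSub L M β (2 * (2 * M))).transpose * hubbardCovAboveCT L M β μ 0 0 klE0 *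
                hubbardGridSub L M β (2 * (2 * M))) (((p₀, σ.rev), 0) : GridLeg (GridPoint L (2 * (2 * M)))) ((p₁, σ.rev), 1) *
                contr ℂ ((hubbardGridSub L M β (2 * (2 * M))).transpose * hubbardCovAboveCT L M β μ 0 0 klE0 *
                hubbardGridSub L M β (2 * (2 * M))) (((p₁, σ.rev), 0) : GridLeg (GridPoint L (2 * (2 * M)))) ((p₀, σ.rev), 1))‖) ≤
        bS k * (((2 * (2 * M) : ℕ) : ℝ) / β)) := by
  have hβ₀ : klBetaMin = 128 := rfl
  have hβpos : 0 < β := by rw [hβ₀] at hβ; linarith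
  -- the near record's side conditions, cast
  have hRcL : 4 * c.Rc + 2 ≤ L := le_trans hRc' ((klEngL₃_ge_of_le hβ hU0 hU).trans hL3)
  have hTmax' : (10 : ℝ)⁻¹ ^ 30 ≤ (c.Tmax : ℝ) := by
    have h := (Rat.cast_le (K := ℝ)).2 hTmax
    push_cast at h
    exact h
  have hrow' : ∀ k : Fin 3, 0 ≤ (c.row k : ℝ) := fun k => by exact_mod_cast hrow k
  -- the far record's side conditions, cast
  have hω₁r : klE0 ≤ (r.ω₁ : ℝ) := by
    have e : klE0 = 1 / 32 := rfl
    have h := (Rat.cast_le (K := ℝ)).2 hω₁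
    push_cast at h
    rw [e]; exact h
  have hω₁r' : (r.ω₁ : ℝ) ≤ 1 / 4 := by
    have h := (Rat.cast_le (K := ℝ)).2 hω₁'
    push_cast at h
    exact h
  have hωRcr : (255 : ℝ) ≤ (r.ω₁ : ℝ) * ((c.Rc : ℝ) + 1) := by exact_mod_cast hωRc
  have hG₂r : (0 : ℝ) ≤ (r.G₂ : ℝ) := by exact_mod_cast hG₂
  have hs₀r : (r.G₀ : ℝ) ≤ (s₀ : ℝ) ^ 2 := by exact_mod_cast hs₀
  have hs₂r : (r.G₂ : ℝ) ≤ (s₂ : ℝ) ^ 2 := by exact_mod_cast hs₂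
  have hs₀0r : (0 : ℝ) ≤ (s₀ : ℝ) := by exact_mod_cast hs₀0
  have hs₂0r : (0 : ℝ) ≤ (s₂ : ℝ) := by exact_mod_cast hs₂0
  -- the gaps at the Matsubara frequencies
  obtain ⟨hg0, hg2⟩ := hgaps_of_farGapCert (M := M) c.toSunsetCellRecordV2 r hr hβpos hμlo hμhi
  refine sunsetRows_of_certV3_klEng (L := L) c hc hμ hμlo hμhi hβ hU0 hU hL3 hM3 hRcL hTmax' hrow' hω₁r hRc hg0 hg2 (bS := bS) fun k => ?_
  have hfar := farBudget_le_rational hω₁r hω₁r' (Rc := c.Rc) hωRcr hG₂r hs₀r hs₂r hs₀0r hs₂0r k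
  exact le_trans (add_le_add le_rfl hfar) (hbS k)

end Records

end Summit.HubbardSuperconductivity.HubbardSuperconductivity.Theorems.KLRegimeSplit

end
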